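import Summits.AtomisticToContinuum.Crystallization.Theorems.ExcessDecayLiouvillePhononStabilityCertChargeAccD
import Summits.AtomisticToContinuum.Crystallization.Theorems.ExcessDecayLiouvillePhononStabilityCertCover

/-!
# Near-certificate layer XII-f: straight chains with general steps (lead c2, vertex scheme)

Support file for crux `PhononStability` (stmt-AtomisticToContinuum-9333), line `contragredient-window-collapse`.

A computable, UNVERIFIED chain constructor for the far classes: greedy descent in the exact rational geometry of
the generator chart (`zhat0`, metric `M0Q`), choosing at each step, among the step classes of squared length
`≤ qs/36` starting at the current sublattice, the one minimising
`‖rem − v‖² + μ · (‖v‖²‖t‖² − ⟪v,t⟫²)/‖t‖²` (remaining vector `rem`, target direction `t`), ties broken by a fixed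
total order of the steps (`stepKeyLE`).  Validity (`IsChain`, non-diagonal steps, steps in the step list) is CHECKED by
the certificate (`validChainsB'`, `stepsOK`), never assumed; the generator reproduces the same exact computation.
-/

namespace Summit.AtomisticToContinuum.Crystallization.Theorems.PhononStabilityCWC.Cert

open Summit.AtomisticToContinuum.Crystallization.Theorems.PhononStabilityNegative
open Summit.AtomisticToContinuum.Crystallization.Theorems.PhononStabilityCWC.FarControlStub

/-- rational triples (eager vectors of the generator chart) -/
abbrev Q3 := ℚ × ℚ × ℚ

/-- component -/
def Q3.at (a : Q3) (i : Fin 3) : ℚ := match i.val with | 0 => a.1 | 1 => a.2.1 | _ => a.2.2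

/-- the rational inner product of the generator chart `aᵀ M₀ b` -/
def dotM0 (a b : Q3) : ℚ :=
  a.1 * (M0Q 0 0 * b.1 + M0Q 0 1 * b.2.1 + M0Q 0 2 * b.2.2)
    + a.2.1 * (M0Q 1 0 * b.1 + M0Q 1 1 * b.2.1 + M0Q 1 2 * b.2.2)
    + a.2.2 * (M0Q 2 0 * b.1 + M0Q 2 1 * b.2.1 + M0Q 2 2 * b.2.2)

/-- the reference direction of a class as a triple -/
def zhat0T (c : BondClass) : Q3 := (zhat0 c 0, zhat0 c 1, zhat0 c 2)

/-- a total preorder key on classes: `(Q, m, m', n₀, n₁, n₂)` compared lexicographically -/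
def stepKeyLE (a b : BondClass) : Bool :=
  let ka : List ℤ := [Qint a, a.1.val, a.2.1.val, a.2.2 0, a.2.2 1, a.2.2 2]
  let kb : List ℤ := [Qint b, b.1.val, b.2.1.val, b.2.2 0, b.2.2 1, b.2.2 2]
  go ka kb
where
  /-- lexicographic comparison -/
  go : List ℤ → List ℤ → Bool
  | [], _ => true
  | _ :: _, [] => false
  | x :: xs, y :: ys => if x < y then true else if y < x then false else go xs ys

/-- the non-diagonal step classes of squared length `≤ qs/36` with their eager directions, in the fixed total order -/
def stepList (qs : ℤ) : List (BondClass × Q3) :=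
  (((classRange 0 qs).filter fun c => decide (0 < Qint c)).mergeSort stepKeyLE).map fun s => (s, zhat0T s)

/-- the greedy cost of a step -/
def stepCost (μ tt : ℚ) (rem t : Q3) (v : Q3) : ℚ :=
  let d : Q3 := (rem.1 - v.1, rem.2.1 - v.2.1, rem.2.2 - v.2.2)
  let vt := dotM0 v t
  dotM0 d d + μ * (dotM0 v v * tt - vt * vt) / (if tt = 0 then 1 else tt)

/-- one greedy step: the best step from sublattice `cur` (`none` if no step starts at `cur`) -/
def bestStep (steps : List (BondClass × Q3)) (μ tt : ℚ) (cur : Fin 2) (rem t : Q3) : Option (BondClass × Q3) :=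
  steps.foldl (fun best s =>
    if s.1.1 = cur then
      match best with
      | none => some s
      | some b => if stepCost μ tt rem t s.2 < stepCost μ tt rem t b.2 then some s else some b
    else best) none

/-- the greedy chain with fuel (returns the partial chain when the fuel runs out; the certificate's validity check
rejects such chains) -/
def chainGreedy (steps : List (BondClass × Q3)) (μ tt : ℚ) (t : Q3) : ℕ → Fin 2 → Fin 2 → Q3 → List BondClass
  | 0, _, _, _ => []
  | fuel + 1, cur, tgtSub, rem =>
    if cur = tgtSub ∧ rem.1 = 0 ∧ rem.2.1 = 0 ∧ rem.2.2 = 0 then []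
    else match bestStep steps μ tt cur rem t with
      | none => []
      | some s => s.1 :: chainGreedy steps μ tt t fuel s.1.2.1 tgtSub (rem.1 - s.2.1, rem.2.1 - s.2.2.1, rem.2.2 - s.2.2.2)

/-- the straight chain of a class for a precomputed step list -/
def chainSOf (steps : List (BondClass × Q3)) (μ : ℚ) (c : BondClass) : List BondClass :=
  let t := zhat0T c
  chainGreedy steps μ (dotM0 t t) t 64 c.1 c.2.1 t

/-- **the straight chain of a class** with steps of squared length `≤ qs/36` and straightness weight `μ`
(for tables, precompute `stepList qs` once and use `chainSOf`) -/
def chainS (qs : ℤ) (μ : ℚ) (c : BondClass) : List BondClass := chainSOf (stepList qs) μ c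

/-- Anchor of this support file (registered stub of the line skeleton, lead c2): the empty class needs no steps. -/
theorem stub_certChainS : chainGreedy [] 0 0 (0, 0, 0) 0 0 0 (0, 0, 0) = [] := by
  rfl

end Summit.AtomisticToContinuum.Crystallization.Theorems.PhononStabilityCWC.Cert
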